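import Mathlib

/-!
# Circulation costs enstrophy on an annulus: `2π ∫ v̄_θ(ρ)² dρ/ρ ≤ ∫_{w ≤ |z| ≤ r} ‖Dv‖²` (t43-S, nsreg-p2 g33 plate; SEEDS-R43 (R43-1))

Planar kinematics (no profile equation).  For a `C¹` vector field `v : ℂ → ℂ` (the plane as `ℂ`, rays `ρ·d(θ)`,
`d(θ) = cos θ + i sin θ`, `d⊥(θ) = −sin θ + i cos θ`), write on the circle of radius `ρ`
`v_r(θ) = Re(v(ρd) d̄)`, `v_θ(θ) = Im(v(ρd) d̄)` (`d̄ = cos θ − i sin θ`).  Then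

* (S1) `hasDerivAt_radialComponent` — `d/dθ v_r = Re(Dv(ρd)[ρ d⊥] d̄) + v_θ`;
* (S2) `integral_swirl_eq_neg_integral` — `∫_{−π}^{π} v_θ dθ = −∫_{−π}^{π} Re(Dv(ρd)[ρd⊥] d̄) dθ` (periodicity of `v_r`);
* (S3) `sq_integral_swirl_le` — `(∫_{−π}^{π} v_θ dθ)² ≤ 2π ρ² ∫_{−π}^{π} ‖Dv(ρ d(θ))‖² dθ` (`|Re(Dv[ρd⊥] d̄)| ≤ ρ‖Dv‖`, Cauchy–Schwarz);
* (S4) `integral_sq_circulation_le_polarEnergy` — `∫_w^r (∫v_θ dθ)²/(2πρ) dρ ≤ ∫_w^r ρ ∫_{−π}^{π} ‖Dv(ρd(θ))‖² dθ dρ` (`0 < w ≤ r`);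
  the right side is `∫_{w ≤ ‖z‖ ≤ r} ‖Dv‖²` by `Condenser.annulusIntegral_eq_integral_polar` (t42b).

Reading (SEEDS-R43 §3): the MEAN swirl `v̄_θ = Γ(ρ)/(2πρ)` (circulation) of ANY planar field costs Dirichlet energy
`2π∫ v̄_θ² dlog ρ` on the annulus — the pointwise `‖Dv‖² ≥ v_θ²/ρ²` being axisymmetric-only (a constant field has `v_θ ≠ 0`,
`Dv = 0`).  WHAT THIS IS NOT: not NS, not E = 19832 (OPEN); 2-D calculus; [folklore].
-/

noncomputable section

open Set MeasureTheory intervalIntegral Complex Real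

set_option linter.dupNamespace false

namespace Summit.NavierStokesRegularity.NavierStokesRegularity.Theorems.PowerGaugeEulerLiouville.Condenser

/-- The unit direction `d(θ) = cos θ + i sin θ`. -/
def dir (θ : ℝ) : ℂ := (Real.cos θ : ℂ) + (Real.sin θ : ℂ) * I

/-- The rotated direction `d⊥(θ) = −sin θ + i cos θ` (`= d′(θ)`). -/
def dirPerp (θ : ℝ) : ℂ := (-(Real.sin θ) : ℂ) + (Real.cos θ : ℂ) * I

/-- The conjugate direction `d̄(θ) = cos θ − i sin θ`. -/
def dirBar (θ : ℝ) : ℂ := (Real.cos θ : ℂ) - (Real.sin θ : ℂ) * I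

/-- `‖d(θ)‖ = 1`. -/
theorem norm_dir (θ : ℝ) : ‖dir θ‖ = 1 := by simp [dir]

/-- `‖d⊥(θ)‖ = 1`. -/
theorem norm_dirPerp (θ : ℝ) : ‖dirPerp θ‖ = 1 := by
  have h : ‖dirPerp θ‖ ^ 2 = 1 := by
    rw [dirPerp, Complex.sq_norm, Complex.normSq_apply]
    simp only [add_re, neg_re, ofReal_re, mul_re, I_re, mul_zero, ofReal_im, I_im, mul_one, sub_self, add_zero,
      add_im, neg_im, neg_zero, mul_im, zero_add]
    nlinarith [Real.sin_sq_add_cos_sq θ]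
  have h0 : 0 ≤ ‖dirPerp θ‖ := norm_nonneg _
  nlinarith [h, h0]

/-- `‖d̄(θ)‖ = 1`. -/
theorem norm_dirBar (θ : ℝ) : ‖dirBar θ‖ = 1 := by
  have h : ‖dirBar θ‖ ^ 2 = 1 := by
    rw [dirBar, Complex.sq_norm, Complex.normSq_apply]
    simp only [sub_re, ofReal_re, mul_re, I_re, mul_zero, ofReal_im, I_im, mul_one, sub_self, sub_zero,
      sub_im, mul_im, add_zero, zero_sub]
    nlinarith [Real.sin_sq_add_cos_sq θ]
  have h0 : 0 ≤ ‖dirBar θ‖ := norm_nonneg _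
  nlinarith [h, h0]

/-- `d(π) = d(−π)` (both are `−1`). -/
theorem dir_neg_pi : dir (-π) = dir π := by simp [dir, Real.cos_neg, Real.sin_neg]

/-- `d̄(π) = d̄(−π)`. -/
theorem dirBar_neg_pi : dirBar (-π) = dirBar π := by simp [dirBar, Real.cos_neg, Real.sin_neg]

/-- `d′ = d⊥`. -/
theorem hasDerivAt_dir (θ : ℝ) : HasDerivAt dir (dirPerp θ) θ := by
  have h1 : HasDerivAt (fun θ : ℝ => (Real.cos θ : ℂ)) ((-Real.sin θ : ℝ) : ℂ) θ := (Real.hasDerivAt_cos θ).ofReal_comp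
  have h2 : HasDerivAt (fun θ : ℝ => (Real.sin θ : ℂ) * I) ((Real.cos θ : ℂ) * I) θ :=
    (Real.hasDerivAt_sin θ).ofReal_comp.mul_const I
  have h := h1.add h2
  convert h using 1 <;> first | rfl | simp only [dirPerp, Complex.ofReal_neg]

/-- `d̄′ = −sin − i cos`. -/
theorem hasDerivAt_dirBar (θ : ℝ) : HasDerivAt dirBar ((-(Real.sin θ) : ℂ) - (Real.cos θ : ℂ) * I) θ := by
  have h1 : HasDerivAt (fun θ : ℝ => (Real.cos θ : ℂ)) ((-Real.sin θ : ℝ) : ℂ) θ := (Real.hasDerivAt_cos θ).ofReal_comp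
  have h2 : HasDerivAt (fun θ : ℝ => (Real.sin θ : ℂ) * I) ((Real.cos θ : ℂ) * I) θ :=
    (Real.hasDerivAt_sin θ).ofReal_comp.mul_const I
  have h := h1.sub h2
  convert h using 1 <;> first | rfl | simp only [Complex.ofReal_neg]

/-- The ray `θ ↦ ρ d(θ)` has derivative `ρ d⊥(θ)`. -/
theorem hasDerivAt_circle (ρ θ : ℝ) : HasDerivAt (fun θ : ℝ => (ρ : ℂ) * dir θ) ((ρ : ℂ) * dirPerp θ) θ :=
  (hasDerivAt_dir θ).const_mul (ρ : ℂ)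

variable {v : ℂ → ℂ}

/-- **(S1) Angular derivative of the radial component.**  `d/dθ Re(v(ρd) d̄) = Re(Dv(ρd)[ρd⊥] d̄) + Im(v(ρd) d̄)`:
the `θ`-derivative of `v_r` is the radial component of the angular derivative PLUS the swirl `v_θ`. [folklore] -/
theorem hasDerivAt_radialComponent (hv : Differentiable ℝ v) (ρ θ : ℝ) :
    HasDerivAt (fun θ : ℝ => (v ((ρ : ℂ) * dir θ) * dirBar θ).re)
      ((fderiv ℝ v ((ρ : ℂ) * dir θ) ((ρ : ℂ) * dirPerp θ) * dirBar θ).re +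
        (v ((ρ : ℂ) * dir θ) * dirBar θ).im) θ := by
  have hvθ : HasDerivAt (fun θ : ℝ => v ((ρ : ℂ) * dir θ)) (fderiv ℝ v ((ρ : ℂ) * dir θ) ((ρ : ℂ) * dirPerp θ)) θ :=
    (hv _).hasFDerivAt.comp_hasDerivAt θ (hasDerivAt_circle ρ θ)
  have hprod := hvθ.mul (hasDerivAt_dirBar θ)
  have hre := (Complex.reCLM.hasFDerivAt.comp_hasDerivAt θ hprod)
  have e : Complex.reCLM (fderiv ℝ v ((ρ : ℂ) * dir θ) ((ρ : ℂ) * dirPerp θ) * dirBar θ +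
      v ((ρ : ℂ) * dir θ) * ((-(Real.sin θ) : ℂ) - (Real.cos θ : ℂ) * I)) =
      (fderiv ℝ v ((ρ : ℂ) * dir θ) ((ρ : ℂ) * dirPerp θ) * dirBar θ).re + (v ((ρ : ℂ) * dir θ) * dirBar θ).im := by
    rw [Complex.reCLM_apply, add_re]
    congr 1
    simp only [dirBar, mul_re, mul_im, sub_re, sub_im, ofReal_re, ofReal_im, neg_re, neg_im, I_re, I_im, mul_zero,
      mul_one, sub_zero, zero_sub, neg_zero, mul_neg]
    ring
  rw [← e]
  exact hre

/-- **(S2) The circulation identity.**  `∫_{−π}^{π} Im(v(ρd) d̄) dθ = −∫_{−π}^{π} Re(Dv(ρd)[ρd⊥] d̄) dθ`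
(integrate (S1) over a period: `v_r(π) = v_r(−π)`). [folklore] -/
theorem integral_swirl_eq_neg_integral (hv : ContDiff ℝ 1 v) (ρ : ℝ) :
    ∫ θ in (-π)..π, (v ((ρ : ℂ) * dir θ) * dirBar θ).im =
      -∫ θ in (-π)..π, (fderiv ℝ v ((ρ : ℂ) * dir θ) ((ρ : ℂ) * dirPerp θ) * dirBar θ).re := by
  have hvd : Differentiable ℝ v := hv.differentiable one_ne_zero
  -- continuity of everything in `θ`
  have hdc : Continuous dir := by unfold dir; fun_prop
  have hdpc : Continuous dirPerp := by unfold dirPerp; fun_prop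
  have hdbc : Continuous dirBar := by unfold dirBar; fun_prop
  have hcirc : Continuous fun θ : ℝ => (ρ : ℂ) * dir θ := continuous_const.mul hdc
  have hvc : Continuous fun θ : ℝ => v ((ρ : ℂ) * dir θ) := hvd.continuous.comp hcirc
  have hDc : Continuous fun θ : ℝ => fderiv ℝ v ((ρ : ℂ) * dir θ) := (hv.continuous_fderiv one_ne_zero).comp hcirc
  have hAc : Continuous fun θ : ℝ => (fderiv ℝ v ((ρ : ℂ) * dir θ) ((ρ : ℂ) * dirPerp θ) * dirBar θ).re :=
    Complex.continuous_re.comp ((hDc.clm_apply (continuous_const.mul hdpc)).mul hdbc)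
  have hSc : Continuous fun θ : ℝ => (v ((ρ : ℂ) * dir θ) * dirBar θ).im :=
    Complex.continuous_im.comp (hvc.mul hdbc)
  -- FTC for `v_r`
  have hftc := integral_eq_sub_of_hasDerivAt (a := -π) (b := π)
    (fun θ _ => hasDerivAt_radialComponent hvd ρ θ) ((hAc.add hSc).intervalIntegrable _ _)
  have hper : (v ((ρ : ℂ) * dir π) * dirBar π).re - (v ((ρ : ℂ) * dir (-π)) * dirBar (-π)).re = 0 := by
    rw [dir_neg_pi, dirBar_neg_pi, sub_self]
  rw [hper, integral_add (hAc.intervalIntegrable _ _) (hSc.intervalIntegrable _ _)] at hftc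
  linarith

/-- `(∫_{−π}^{π} f)² ≤ 2π ∫_{−π}^{π} f²` for continuous `f` (Cauchy–Schwarz against the constant `1`). [folklore] -/
theorem sq_integral_le_two_pi_mul_integral_sq {f : ℝ → ℝ} (hf : Continuous f) :
    (∫ θ in (-π)..π, f θ) ^ 2 ≤ 2 * π * ∫ θ in (-π)..π, f θ ^ 2 := by
  set C := ∫ θ in (-π)..π, f θ with hC
  set E := ∫ θ in (-π)..π, f θ ^ 2 with hE
  set m := C / (2 * π) with hm
  have hπ : 0 < 2 * π := by linarith [Real.pi_pos]
  -- `0 ≤ ∫ (f − m)² = E − 2 m C + 2π m²`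
  have h0 : 0 ≤ ∫ θ in (-π)..π, (f θ - m) ^ 2 :=
    integral_nonneg (by linarith [Real.pi_pos]) fun θ _ => sq_nonneg _
  have hexp : ∫ θ in (-π)..π, (f θ - m) ^ 2 = E - 2 * m * C + 2 * π * m ^ 2 := by
    have i1 : IntervalIntegrable (fun θ => f θ ^ 2) volume (-π) π := (hf.pow 2).intervalIntegrable _ _
    have i2 : IntervalIntegrable (fun θ => 2 * m * f θ) volume (-π) π :=
      (continuous_const.mul hf).intervalIntegrable _ _
    have i12 : IntervalIntegrable (fun θ => f θ ^ 2 - 2 * m * f θ) volume (-π) π := i1.sub i2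
    have i3 : IntervalIntegrable (fun _ : ℝ => m ^ 2) volume (-π) π := continuous_const.intervalIntegrable _ _
    have e1 : (fun θ => (f θ - m) ^ 2) = fun θ => (f θ ^ 2 - 2 * m * f θ) + m ^ 2 := by
      funext θ; ring
    rw [e1, intervalIntegral.integral_add i12 i3, intervalIntegral.integral_sub i1 i2,
      intervalIntegral.integral_const_mul, intervalIntegral.integral_const, smul_eq_mul]
    ring
  rw [hexp, hm] at h0
  have key : E - 2 * (C / (2 * π)) * C + 2 * π * (C / (2 * π)) ^ 2 = E - C ^ 2 / (2 * π) := by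
    field_simp
    ring
  rw [key] at h0
  have h1 : C ^ 2 / (2 * π) ≤ E := by linarith
  rwa [div_le_iff₀ hπ, mul_comm] at h1

/-- **(S3) Circulation is bounded by the angular Dirichlet energy.**
`(∫_{−π}^{π} v_θ dθ)² ≤ 2π ρ² ∫_{−π}^{π} ‖Dv(ρ d(θ))‖² dθ` for `0 ≤ ρ`. [folklore] -/
theorem sq_integral_swirl_le (hv : ContDiff ℝ 1 v) {ρ : ℝ} (hρ : 0 ≤ ρ) :
    (∫ θ in (-π)..π, (v ((ρ : ℂ) * dir θ) * dirBar θ).im) ^ 2 ≤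
      2 * π * ρ ^ 2 * ∫ θ in (-π)..π, ‖fderiv ℝ v ((ρ : ℂ) * dir θ)‖ ^ 2 := by
  have hdc : Continuous dir := by unfold dir; fun_prop
  have hdpc : Continuous dirPerp := by unfold dirPerp; fun_prop
  have hdbc : Continuous dirBar := by unfold dirBar; fun_prop
  have hcirc : Continuous fun θ : ℝ => (ρ : ℂ) * dir θ := continuous_const.mul hdc
  have hDc : Continuous fun θ : ℝ => fderiv ℝ v ((ρ : ℂ) * dir θ) := (hv.continuous_fderiv one_ne_zero).comp hcirc
  have hAc : Continuous fun θ : ℝ => (fderiv ℝ v ((ρ : ℂ) * dir θ) ((ρ : ℂ) * dirPerp θ) * dirBar θ).re :=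
    Complex.continuous_re.comp ((hDc.clm_apply (continuous_const.mul hdpc)).mul hdbc)
  have hNc : Continuous fun θ : ℝ => ‖fderiv ℝ v ((ρ : ℂ) * dir θ)‖ := hDc.norm
  -- pointwise: `|Re(Dv[ρd⊥] d̄)| ≤ ρ ‖Dv‖`
  have hpt : ∀ θ, |(fderiv ℝ v ((ρ : ℂ) * dir θ) ((ρ : ℂ) * dirPerp θ) * dirBar θ).re| ≤
      ρ * ‖fderiv ℝ v ((ρ : ℂ) * dir θ)‖ := by
    intro θ
    calc |(fderiv ℝ v ((ρ : ℂ) * dir θ) ((ρ : ℂ) * dirPerp θ) * dirBar θ).re|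
        ≤ ‖fderiv ℝ v ((ρ : ℂ) * dir θ) ((ρ : ℂ) * dirPerp θ) * dirBar θ‖ := Complex.abs_re_le_norm _
      _ = ‖fderiv ℝ v ((ρ : ℂ) * dir θ) ((ρ : ℂ) * dirPerp θ)‖ := by rw [norm_mul, norm_dirBar, mul_one]
      _ ≤ ‖fderiv ℝ v ((ρ : ℂ) * dir θ)‖ * ‖(ρ : ℂ) * dirPerp θ‖ := ContinuousLinearMap.le_opNorm _ _
      _ = ρ * ‖fderiv ℝ v ((ρ : ℂ) * dir θ)‖ := by
          rw [norm_mul, norm_dirPerp, mul_one, Complex.norm_real, Real.norm_eq_abs, abs_of_nonneg hρ, mul_comm]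
  -- `|∫ v_θ| ≤ ρ ∫ ‖Dv‖`
  have hI : |∫ θ in (-π)..π, (v ((ρ : ℂ) * dir θ) * dirBar θ).im| ≤
      ρ * ∫ θ in (-π)..π, ‖fderiv ℝ v ((ρ : ℂ) * dir θ)‖ := by
    rw [integral_swirl_eq_neg_integral hv ρ, abs_neg, ← intervalIntegral.integral_const_mul]
    have hle : -π ≤ π := by linarith [Real.pi_pos]
    refine (intervalIntegral.abs_integral_le_integral_abs hle).trans ?_
    exact intervalIntegral.integral_mono_on hle (hAc.abs.intervalIntegrable _ _)
      ((continuous_const.mul hNc).intervalIntegrable _ _) fun θ _ => hpt θ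
  have hCS := sq_integral_le_two_pi_mul_integral_sq hNc
  have hJ0 : 0 ≤ ∫ θ in (-π)..π, ‖fderiv ℝ v ((ρ : ℂ) * dir θ)‖ :=
    integral_nonneg (by linarith [Real.pi_pos]) fun θ _ => norm_nonneg _
  calc (∫ θ in (-π)..π, (v ((ρ : ℂ) * dir θ) * dirBar θ).im) ^ 2
      = |∫ θ in (-π)..π, (v ((ρ : ℂ) * dir θ) * dirBar θ).im| ^ 2 := (sq_abs _).symm
    _ ≤ (ρ * ∫ θ in (-π)..π, ‖fderiv ℝ v ((ρ : ℂ) * dir θ)‖) ^ 2 :=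
        pow_le_pow_left₀ (abs_nonneg _) hI 2
    _ = ρ ^ 2 * (∫ θ in (-π)..π, ‖fderiv ℝ v ((ρ : ℂ) * dir θ)‖) ^ 2 := by ring
    _ ≤ ρ ^ 2 * (2 * π * ∫ θ in (-π)..π, ‖fderiv ℝ v ((ρ : ℂ) * dir θ)‖ ^ 2) :=
        mul_le_mul_of_nonneg_left hCS (sq_nonneg _)
    _ = 2 * π * ρ ^ 2 * ∫ θ in (-π)..π, ‖fderiv ℝ v ((ρ : ℂ) * dir θ)‖ ^ 2 := by ring

/-- **(S4) Circulation costs enstrophy on an annulus** (polar form).  For `0 < w ≤ r`: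
`∫_w^r (∫_{−π}^{π} v_θ(ρ,θ) dθ)² / (2πρ) dρ ≤ ∫_w^r ρ ∫_{−π}^{π} ‖Dv(ρ d(θ))‖² dθ dρ`; with `Γ(ρ) = ∫v_θ ρ dθ`-free
normalisation `v̄_θ := (2π)⁻¹∫v_θ dθ` the left side is `2π ∫_w^r v̄_θ(ρ)² dρ/ρ`, and the right side is the Dirichlet energy of
`v` on `{w ≤ ‖z‖ ≤ r}` (t42b `annulusIntegral_eq_integral_polar`). [folklore] -/
theorem integral_sq_circulation_le_polarEnergy (hv : ContDiff ℝ 1 v) {w r : ℝ} (hw : 0 < w) (hwr : w ≤ r) :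
    ∫ ρ in w..r, (∫ θ in (-π)..π, (v ((ρ : ℂ) * dir θ) * dirBar θ).im) ^ 2 / (2 * π * ρ) ≤
      ∫ ρ in w..r, ρ * ∫ θ in (-π)..π, ‖fderiv ℝ v ((ρ : ℂ) * dir θ)‖ ^ 2 := by
  have hvd : Differentiable ℝ v := hv.differentiable one_ne_zero
  have hdc : Continuous dir := by unfold dir; fun_prop
  have hdbc : Continuous dirBar := by unfold dirBar; fun_prop
  -- joint continuity in `(ρ, θ)`
  have hray2 : Continuous fun p : ℝ × ℝ => ((p.1 : ℂ) * dir p.2) :=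
    (continuous_ofReal.comp continuous_fst).mul (hdc.comp continuous_snd)
  have hS2 : Continuous fun p : ℝ × ℝ => (v ((p.1 : ℂ) * dir p.2) * dirBar p.2).im :=
    Complex.continuous_im.comp ((hvd.continuous.comp hray2).mul (hdbc.comp continuous_snd))
  have hN2 : Continuous fun p : ℝ × ℝ => ‖fderiv ℝ v ((p.1 : ℂ) * dir p.2)‖ ^ 2 :=
    (((hv.continuous_fderiv one_ne_zero).comp hray2).norm).pow 2
  -- continuity in `ρ` of the parametric integrals
  have hCc : Continuous fun ρ : ℝ => ∫ θ in (-π)..π, (v ((ρ : ℂ) * dir θ) * dirBar θ).im :=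
    intervalIntegral.continuous_parametric_intervalIntegral_of_continuous' hS2 (-π) π
  have hEc : Continuous fun ρ : ℝ => ∫ θ in (-π)..π, ‖fderiv ℝ v ((ρ : ℂ) * dir θ)‖ ^ 2 :=
    intervalIntegral.continuous_parametric_intervalIntegral_of_continuous' hN2 (-π) π
  have hLc : ContinuousOn (fun ρ : ℝ => (∫ θ in (-π)..π, (v ((ρ : ℂ) * dir θ) * dirBar θ).im) ^ 2 / (2 * π * ρ))
      (uIcc w r) := by
    refine ((hCc.pow 2).continuousOn).div (continuous_const.mul continuous_id).continuousOn fun ρ hρ => ?_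
    rw [uIcc_of_le hwr] at hρ
    have : 0 < ρ := hw.trans_le hρ.1
    positivity
  refine intervalIntegral.integral_mono_on hwr (hLc.intervalIntegrable) ((continuous_id.mul hEc).intervalIntegrable _ _)
    fun ρ hρ => ?_
  have hρ0 : 0 < ρ := hw.trans_le hρ.1
  have h3 := sq_integral_swirl_le hv hρ0.le
  have h2π : 0 < 2 * π * ρ := by positivity
  rw [div_le_iff₀ h2π]
  calc (∫ θ in (-π)..π, (v ((ρ : ℂ) * dir θ) * dirBar θ).im) ^ 2
      ≤ 2 * π * ρ ^ 2 * ∫ θ in (-π)..π, ‖fderiv ℝ v ((ρ : ℂ) * dir θ)‖ ^ 2 := h3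
    _ = (ρ * ∫ θ in (-π)..π, ‖fderiv ℝ v ((ρ : ℂ) * dir θ)‖ ^ 2) * (2 * π * ρ) := by ring

end Summit.NavierStokesRegularity.NavierStokesRegularity.Theorems.PowerGaugeEulerLiouville.Condenser
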